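import Literature.GroupTheory.CombinatorialGroupTheory.PuncturedSurfaceGroupNodeLoopBasis
import HarnessLib

/-!
# The node-loop basis of `Γ_{g,r}`: both subsurface groups as sub-bases, and the two odd cusps

Topic `Literature/GroupTheory/CombinatorialGroupTheory`; theorems only.  `Γ_{g,r} = ⟨a_i, b_i, c_j ∣
∏_i [a_i,b_i] · c_0 ⋯ c_{r−1}⟩` (`PuncturedSurfaceGroup g r`, [SemiAnbd] Example 2.10
[cite: MochizukiSemiAnbd2006, Ex. 2.10 p.31]).  Continuation of abc-iut-f-166's
`PuncturedSurfaceGroupNodeLoopBasis.lean` for the two-component affine degeneration of abc-iut-f-164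
(`PSCTwoComponentAffineShape.lean`: components `C₀ ∪_ν C₁`, handles `i < g₀` and cusps `s ≤ j` on `C₀`,
the others on `C₁`; node loop `ε = (c_s ⋯ c_{r−1}) · ∏_{i<g₀} [a_i, b_i]`).  In the node-loop free basis
`b' = (a_i, b_i, c_1, …, c_{s−1}, ε, c_{s+1}, …, c_{r−1})` (`exists_freeGroupBasis_nodeLoop`):
`closure_firstSubsurface_eq_nodeLoopBasis` — the FIRST subsurface group `⟨a_i, b_i (i<g₀), c_j (j ≥ s)⟩`
is the sub-basis closure of `{a_i, b_i (i<g₀)} ∪ {ε, c_{s+1}, …, c_{r−1}}` (as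
`c_s = ε (∏_{i<g₀}[a_i,b_i])⁻¹ (c_{s+1}⋯c_{r−1})⁻¹`), so ONE basis carries both subsurface groups, meeting
in the member `ε`; `closure_secondSubsurface_eq_nodeLoopBasis` — the second one,
`⟨a_i, b_i (i ≥ g₀), c_j (j<s), ε⟩ = ⟨{a_i, b_i (i ≥ g₀)} ∪ {c_1, …, c_{s−1}, ε}⟩` (abc-iut-f-166's in-proof
computation, as a lemma); Nielsen moves `exists_freeGroupBasis_update_inv` (`b_k ↦ b_k⁻¹`),
`exists_freeGroupBasis_update_mul_inv` (`b_k ↦ u · b_k⁻¹`); `exists_freeGroupBasis_nodeLoop_cusp` — the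
move `c_{s+1} ↦ c_s = [ε (∏_{i<g₀}[a_i,b_i])⁻¹ (c_{s+2}⋯c_{r−1})⁻¹] · c_{s+1}⁻¹` (needs `r − s ≥ 2`);
`exists_freeGroupBasis_nodeLoop_cusp_zero` — the move `c_1 ↦ c_0 = [(∏_{i≥g₀}[a_i,b_i])⁻¹ ε⁻¹
(c_2⋯c_{s−1})⁻¹] · c_1⁻¹` (needs `s ≥ 2`).  So every cusp `c_j` is a basis member OUTSIDE the sub-basis of
the component it does not lie on — the input of free-factor disjointness (`ProSigmaFreeFactorDisjoint.lean`)
for [CombGC] Prop. 1.5 (i) at two-component affine data.  Elementary combinatorial group theory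
(Lyndon–Schupp I.3, Nielsen transformations); nothing here concerns [IUTchIII].
-/
namespace Literature.GroupTheory.CombinatorialGroupTheory

/-! ### Two more Nielsen moves -/

section Nielsen

variable {ι G : Type*} [Group G]

/-- Local copy of `b.lift f (b i) = f i`. [cite: LyndonSchupp2001, I.3 Prop 3.8] -/
private theorem lift_apply_basis₃ {H : Type*} [Group H] (b : FreeGroupBasis ι G) (f : ι → H) (i : ι) :
    b.lift f (b i) = f i := by
  change FreeGroup.lift f (b.repr (b i)) = f i
  rw [FreeGroupBasis.repr_apply_coe, FreeGroup.lift_apply_of]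

/-- Families agreeing on `S` generate the same subgroup on `S`. [cite: LyndonSchupp2001, I.3 Prop 3.8] -/
theorem closure_image_congr {β : Type*} {b₁ b₂ : β → G} {S : Set β} (h : ∀ x ∈ S, b₁ x = b₂ x) :
    Subgroup.closure (b₁ '' S) = Subgroup.closure (b₂ '' S) := by
  rw [Set.image_congr h]

/-- The subgroup generated by one basis member is its cyclic subgroup. [cite: LyndonSchupp2001, I.3 Prop 3.8] -/
theorem closure_image_singleton {β : Type*} (b : β → G) (k : β) :
    Subgroup.closure (b '' {k}) = Subgroup.zpowers (b k) := by
  rw [Set.image_singleton, Subgroup.zpowers_eq_closure]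

/-- **Nielsen move: inverting one member** of a free basis gives a free basis.
[cite: LyndonSchupp2001, I.3 Prop 3.8] -/
theorem exists_freeGroupBasis_update_inv [DecidableEq ι] (b : FreeGroupBasis ι G) (k : ι) :
    ∃ b' : FreeGroupBasis ι G, b' k = (b k)⁻¹ ∧ ∀ j, j ≠ k → b' j = b j := by
  let f : ι → G := Function.update b k (b k)⁻¹
  have hfk : f k = (b k)⁻¹ := Function.update_self _ _ _
  have hf : ∀ j, j ≠ k → f j = b j := fun j hj => Function.update_of_ne hj _ _
  have hff : ∀ i, b.lift f (f i) = b i := fun i => by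
    by_cases hi : i = k
    · subst hi
      rw [hfk, map_inv, lift_apply_basis₃, hfk, inv_inv]
    · rw [hf i hi, lift_apply_basis₃, hf i hi]
  obtain ⟨b', hb'⟩ := PuncturedSurfaceGroup.exists_freeGroupBasis_of_lifts b f f hff hff
  exact ⟨b', by rw [hb', hfk], fun j hj => by rw [hb', hf j hj]⟩

/-- **Nielsen move, left form.**  If `b` is a free basis of `G`, `k` an index and `u` a word in the OTHER
members `b_j`, `j ≠ k`, then replacing `b_k` by `u · b_k⁻¹` yields a free basis.
[cite: LyndonSchupp2001, I.3 Prop 3.8] -/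
theorem exists_freeGroupBasis_update_mul_inv [DecidableEq ι] (b : FreeGroupBasis ι G) (k : ι) (u : G)
    (hu : u ∈ Subgroup.closure (b '' {j | j ≠ k})) :
    ∃ b' : FreeGroupBasis ι G, b' k = u * (b k)⁻¹ ∧ ∀ j, j ≠ k → b' j = b j := by
  obtain ⟨b₁, hb₁k, hb₁⟩ := exists_freeGroupBasis_update_mul b k u⁻¹ (Subgroup.inv_mem _ hu)
  obtain ⟨b₂, hb₂k, hb₂⟩ := exists_freeGroupBasis_update_inv b₁ k
  exact ⟨b₂, by rw [hb₂k, hb₁k, mul_inv_rev, inv_inv], fun j hj => by rw [hb₂ j hj, hb₁ j hj]⟩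

end Nielsen

namespace PuncturedSurfaceGroup

variable {g r : ℕ}

/-- `c_1 ⋯ c_{s−1} = c_1 · (c_2 ⋯ c_{s−1})` for `2 ≤ s`, `1 < r`. [cite: MochizukiSemiAnbd2006, Ex. 2.10 p.31] -/
theorem cusp_prod_one_le_lt_eq_c_one_mul (s : ℕ) (hs : 2 ≤ s) (hr : 1 < r) :
    ((List.finRange r).map fun j : Fin r =>
        if 1 ≤ (j : ℕ) ∧ (j : ℕ) < s then c (g := g) j else 1).prod =
      c ⟨1, hr⟩ * ((List.finRange r).map fun j : Fin r =>
        if 2 ≤ (j : ℕ) ∧ (j : ℕ) < s then c (g := g) j else 1).prod := by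
  classical
  rw [prod_map_finRange_split r 2
    (fun j : Fin r => if 1 ≤ (j : ℕ) ∧ (j : ℕ) < s then c (g := g) j else 1)]
  have e1 : (fun i : Fin r => if (i : ℕ) < 2 then
        (if 1 ≤ (i : ℕ) ∧ (i : ℕ) < s then c (g := g) i else 1) else 1) =
      fun i : Fin r => if i = ⟨1, hr⟩ then c (g := g) i else 1 := by
    funext i
    by_cases h : i = ⟨1, hr⟩
    · subst h
      rw [if_pos rfl, if_pos (show ((⟨1, hr⟩ : Fin r) : ℕ) < 2 by change (1 : ℕ) < 2; omega),
        if_pos ⟨le_rfl, show ((⟨1, hr⟩ : Fin r) : ℕ) < s by change 1 < s; omega⟩]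
    · have h' : (i : ℕ) ≠ 1 := fun e => h (Fin.ext e)
      rw [if_neg h]
      by_cases h2 : (i : ℕ) < 2
      · rw [if_pos h2, if_neg (by omega)]
      · rw [if_neg h2]
  have e2 : (fun i : Fin r => if 2 ≤ (i : ℕ) then
        (if 1 ≤ (i : ℕ) ∧ (i : ℕ) < s then c (g := g) i else 1) else 1) =
      fun i : Fin r => if 2 ≤ (i : ℕ) ∧ (i : ℕ) < s then c (g := g) i else 1 := by
    funext i
    by_cases h1 : 2 ≤ (i : ℕ)
    · by_cases h2 : (i : ℕ) < s
      · rw [if_pos h1, if_pos ⟨by omega, h2⟩, if_pos ⟨h1, h2⟩]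
      · rw [if_pos h1, if_neg (fun h => h2 h.2), if_neg (fun h => h2 h.2)]
    · rw [if_neg h1, if_neg (fun h => h1 h.1)]
  rw [e1, e2, prod_map_finRange_ite_eq_single]

/-! ### The two subsurface groups in the node-loop basis -/

section NodeLoopBasis

variable {r' : ℕ} {g₀ s : ℕ} {ε : PuncturedSurfaceGroup g (r' + 1)}
  {b' : FreeGroupBasis ((Fin g × Bool) ⊕ Fin r') (PuncturedSurfaceGroup g (r' + 1))}

/-- A windowed handle product `∏ [a_i,b_i]` lies in any subgroup containing those `a_i`, `b_i`.
[cite: MochizukiSemiAnbd2006, Ex. 2.10 p.31] -/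
theorem comm_prod_ite_mem (H : Subgroup (PuncturedSurfaceGroup g (r' + 1))) (p : Fin g → Prop)
    [DecidablePred p] (ha : ∀ i, p i → a (r := r' + 1) i ∈ H) (hb : ∀ i, p i → b (r := r' + 1) i ∈ H) :
    ((List.finRange g).map fun i : Fin g => if p i then
        a (r := r' + 1) i * b i * (a i)⁻¹ * (b i)⁻¹ else 1).prod ∈ H :=
  prod_map_finRange_ite_mem H g p _ fun i hi =>
    H.mul_mem (H.mul_mem (H.mul_mem (ha i hi) (hb i hi)) (H.inv_mem (ha i hi))) (H.inv_mem (hb i hi))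

variable (hε : ε = ((List.finRange (r' + 1)).map fun j : Fin (r' + 1) =>
        if s ≤ (j : ℕ) then c (g := g) j else 1).prod *
      ((List.finRange g).map fun i : Fin g => if (i : ℕ) < g₀ then
        a (r := r' + 1) i * b i * (a i)⁻¹ * (b i)⁻¹ else 1).prod)
  (ha : ∀ i, b' (Sum.inl (i, false)) = a i) (hb : ∀ i, b' (Sum.inl (i, true)) = b i)
  (hc : ∀ j : Fin r', (j : ℕ) + 1 ≠ s → b' (Sum.inr j) = c (Fin.succ j))
  (hk : ∀ h : s - 1 < r', b' (Sum.inr ⟨s - 1, h⟩) = ε)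

include hc in
/-- A cusp `c_j` (`j ≥ 1`, `j ≠ s`) is the member of `b'` at `j − 1`: membership in sub-basis closures.
[cite: MochizukiSemiAnbd2006, Ex. 2.10 p.31] -/
theorem nodeLoopBasis_cusp_mem_closure {S : Set ((Fin g × Bool) ⊕ Fin r')} (j : Fin (r' + 1))
    (hj0 : (j : ℕ) ≠ 0) (hjs : (j : ℕ) ≠ s) (hS : ∀ k : Fin r', (k : ℕ) + 1 = (j : ℕ) → Sum.inr k ∈ S) :
    c (g := g) j ∈ Subgroup.closure (b' '' S) := by
  have e1 : b' (Sum.inr (j.pred (fun h => hj0 (by rw [h]; rfl)))) = c j := by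
    rw [hc _ (by rw [Fin.val_pred]; omega), Fin.succ_pred]
  rw [← e1]
  exact Subgroup.subset_closure ⟨_, hS _ (by rw [Fin.val_pred]; omega), rfl⟩

include hε ha hb hc hk in
/-- **The first subsurface group in the node-loop basis.**  For `1 ≤ s ≤ r'` (so `r = r' + 1 > s`),
`ε = (c_s⋯c_{r'}) ∏_{i<g₀}[a_i,b_i]` and the node-loop basis `b'` (`b'(j) = c_{j+1}` for `j+1 ≠ s`,
`b'(s−1) = ε`): `⟨a_i, b_i (i<g₀), c_j (j ≥ s)⟩ = ⟨b'(x) : x ∈ S₀⟩` with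
`S₀ = {(i,·) : i < g₀} ∪ {j : s ≤ j+1}` — the member `ε` replaces `c_s = ε (∏_{i<g₀}[a_i,b_i])⁻¹ (c_{s+1}⋯c_{r'})⁻¹`.
[cite: MochizukiSemiAnbd2006, Ex. 2.10 p.31] -/
theorem closure_firstSubsurface_eq_nodeLoopBasis (hs1 : 1 ≤ s) (hsr : s ≤ r') :
    Subgroup.closure {x : PuncturedSurfaceGroup g (r' + 1) |
        (∃ i : Fin g, (i : ℕ) < g₀ ∧ (x = a i ∨ x = b i)) ∨ ∃ j : Fin (r' + 1), s ≤ (j : ℕ) ∧ x = c j} =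
      Subgroup.closure (b' '' {x | Sum.elim (fun p : Fin g × Bool => (p.1 : ℕ) < g₀)
        (fun j : Fin r' => s ≤ (j : ℕ) + 1) x}) := by
  classical
  set S₀ : Set ((Fin g × Bool) ⊕ Fin r') :=
    {x | Sum.elim (fun p : Fin g × Bool => (p.1 : ℕ) < g₀) (fun j : Fin r' => s ≤ (j : ℕ) + 1) x} with hS₀
  have hSl : ∀ p : Fin g × Bool, (Sum.inl p : (Fin g × Bool) ⊕ Fin r') ∈ S₀ ↔ (p.1 : ℕ) < g₀ :=
    fun _ => Iff.rfl
  have hSr : ∀ j : Fin r', (Sum.inr j : (Fin g × Bool) ⊕ Fin r') ∈ S₀ ↔ s ≤ (j : ℕ) + 1 := fun _ => Iff.rfl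
  have hsr' : s < r' + 1 := by omega
  -- members of the right-hand side
  have haR : ∀ i : Fin g, (i : ℕ) < g₀ → a (r := r' + 1) i ∈ Subgroup.closure (b' '' S₀) := fun i hi =>
    Subgroup.subset_closure ⟨Sum.inl (i, false), (hSl _).mpr hi, ha i⟩
  have hbR : ∀ i : Fin g, (i : ℕ) < g₀ → b (r := r' + 1) i ∈ Subgroup.closure (b' '' S₀) := fun i hi =>
    Subgroup.subset_closure ⟨Sum.inl (i, true), (hSl _).mpr hi, hb i⟩
  have hεR : ε ∈ Subgroup.closure (b' '' S₀) := by
    rw [← hk (by omega)]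
    exact Subgroup.subset_closure ⟨_, (hSr _).mpr (by simp only; omega), rfl⟩
  have hcR : ∀ j : Fin (r' + 1), s + 1 ≤ (j : ℕ) → c (g := g) j ∈ Subgroup.closure (b' '' S₀) :=
    fun j hj => nodeLoopBasis_cusp_mem_closure hc j (by omega) (by omega) fun k hk' =>
      (hSr _).mpr (by omega)
  -- `c_s = ε · ((c_{s+1}⋯c_{r'}) ∏_{i<g₀}[a_i,b_i])⁻¹`
  have hcs : c (g := g) ⟨s, hsr'⟩ ∈ Subgroup.closure (b' '' S₀) := by
    have h := nodeLoop_eq_c_mul (g := g) g₀ s hsr' ε hε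
    have e : c (g := g) ⟨s, hsr'⟩ = ε *
        (((List.finRange (r' + 1)).map fun j : Fin (r' + 1) =>
            if s + 1 ≤ (j : ℕ) then c (g := g) j else 1).prod *
          ((List.finRange g).map fun i : Fin g => if (i : ℕ) < g₀ then
            a (r := r' + 1) i * b i * (a i)⁻¹ * (b i)⁻¹ else 1).prod)⁻¹ := by
      rw [h, mul_inv_cancel_right]
    rw [e]
    exact Subgroup.mul_mem _ hεR (Subgroup.inv_mem _ (Subgroup.mul_mem _
      (prod_map_finRange_ite_mem _ _ _ _ hcR) (comm_prod_ite_mem _ _ haR hbR)))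
  apply le_antisymm
  · rw [Subgroup.closure_le]
    rintro x (⟨i, hi, rfl | rfl⟩ | ⟨j, hj, rfl⟩)
    · exact haR i hi
    · exact hbR i hi
    · by_cases hjs : (j : ℕ) = s
      · have : j = ⟨s, hsr'⟩ := Fin.ext hjs
        rw [this]; exact hcs
      · exact hcR j (by omega)
  · rw [Subgroup.closure_le]
    rintro _ ⟨y, hy, rfl⟩
    rcases y with ⟨i, _ | _⟩ | j
    · exact Subgroup.subset_closure (Or.inl ⟨i, (hSl _).mp hy, Or.inl (ha i)⟩)
    · exact Subgroup.subset_closure (Or.inl ⟨i, (hSl _).mp hy, Or.inr (hb i)⟩)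
    · have hj : s ≤ (j : ℕ) + 1 := (hSr _).mp hy
      by_cases hjs : (j : ℕ) + 1 = s
      · -- the member `ε`: a word in the generators of the first component
        have : j = ⟨s - 1, by omega⟩ := Fin.ext (by simp only; omega)
        rw [this, hk (by omega), hε]
        refine Subgroup.mul_mem _ (prod_map_finRange_ite_mem _ _ _ _ fun j hj =>
            Subgroup.subset_closure (Or.inr ⟨j, hj, rfl⟩))
          (comm_prod_ite_mem _ _ (fun i hi => Subgroup.subset_closure (Or.inl ⟨i, hi, Or.inl rfl⟩))
            (fun i hi => Subgroup.subset_closure (Or.inl ⟨i, hi, Or.inr rfl⟩)))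
      · rw [hc j hjs]
        exact Subgroup.subset_closure (Or.inr ⟨Fin.succ j, by rw [Fin.val_succ]; omega, rfl⟩)

include hε ha hb hc hk in
/-- **The second subsurface group in the node-loop basis** (abc-iut-f-166's in-proof computation):
for `1 ≤ s ≤ r'`, `⟨a_i, b_i (i ≥ g₀), c_j (j < s), ε⟩ = ⟨b'(x) : x ∈ T₁⟩` with
`T₁ = {(i,·) : g₀ ≤ i} ∪ {j : j+1 ≤ s}` — `c_0` is recovered from the relation of the second component
`(∏_{i≥g₀}[a_i,b_i]) c_0 ⋯ c_{s−1} ε = 1` (`nodeLoop_rel`). [cite: MochizukiSemiAnbd2006, Ex. 2.10 p.31] -/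
theorem closure_secondSubsurface_eq_nodeLoopBasis (hs1 : 1 ≤ s) (hsr : s ≤ r') :
    Subgroup.closure {x : PuncturedSurfaceGroup g (r' + 1) |
        (∃ i : Fin g, g₀ ≤ (i : ℕ) ∧ (x = a i ∨ x = b i)) ∨
          (∃ j : Fin (r' + 1), (j : ℕ) < s ∧ x = c j) ∨ x = ε} =
      Subgroup.closure (b' '' {x | Sum.elim (fun p : Fin g × Bool => g₀ ≤ (p.1 : ℕ))
        (fun j : Fin r' => (j : ℕ) + 1 ≤ s) x}) := by
  classical
  set T₁ : Set ((Fin g × Bool) ⊕ Fin r') :=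
    {x | Sum.elim (fun p : Fin g × Bool => g₀ ≤ (p.1 : ℕ)) (fun j : Fin r' => (j : ℕ) + 1 ≤ s) x} with hT₁
  have hTl : ∀ p : Fin g × Bool, (Sum.inl p : (Fin g × Bool) ⊕ Fin r') ∈ T₁ ↔ g₀ ≤ (p.1 : ℕ) :=
    fun _ => Iff.rfl
  have hTr : ∀ j : Fin r', (Sum.inr j : (Fin g × Bool) ⊕ Fin r') ∈ T₁ ↔ (j : ℕ) + 1 ≤ s := fun _ => Iff.rfl
  have hr0 : 0 < r' + 1 := Nat.succ_pos r'
  have haT : ∀ i : Fin g, g₀ ≤ (i : ℕ) → a (r := r' + 1) i ∈ Subgroup.closure (b' '' T₁) := fun i hi =>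
    Subgroup.subset_closure ⟨Sum.inl (i, false), (hTl _).mpr hi, ha i⟩
  have hbT : ∀ i : Fin g, g₀ ≤ (i : ℕ) → b (r := r' + 1) i ∈ Subgroup.closure (b' '' T₁) := fun i hi =>
    Subgroup.subset_closure ⟨Sum.inl (i, true), (hTl _).mpr hi, hb i⟩
  have hεT : ε ∈ Subgroup.closure (b' '' T₁) := by
    rw [← hk (by omega)]
    exact Subgroup.subset_closure ⟨_, (hTr _).mpr (by simp only; omega), rfl⟩
  have hcT : ∀ j : Fin (r' + 1), 1 ≤ (j : ℕ) ∧ (j : ℕ) < s → c (g := g) j ∈ Subgroup.closure (b' '' T₁) :=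
    fun j hj => nodeLoopBasis_cusp_mem_closure hc j (by omega) (by omega) fun k hk' =>
      (hTr _).mpr (by omega)
  -- `c_0 = (∏_{i≥g₀}[a_i,b_i])⁻¹ ((c_1⋯c_{s-1}) ε)⁻¹`
  have hc0 : c (g := g) ⟨0, hr0⟩ ∈ Subgroup.closure (b' '' T₁) := by
    have hrel := nodeLoop_rel (g := g) (r := r' + 1) g₀ s ε hε
    rw [cusp_prod_lt_eq_c_zero_mul (g := g) s (by omega) hr0] at hrel
    set Y := ((List.finRange g).map fun i : Fin g => if g₀ ≤ (i : ℕ) then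
        a (r := r' + 1) i * b i * (a i)⁻¹ * (b i)⁻¹ else 1).prod with hY
    set Cp := ((List.finRange (r' + 1)).map fun j : Fin (r' + 1) =>
        if 1 ≤ (j : ℕ) ∧ (j : ℕ) < s then c (g := g) j else 1).prod with hC
    have hc0eq : c (g := g) ⟨0, hr0⟩ = Y⁻¹ * (Cp * ε)⁻¹ := by
      have h1 : Y * (c (g := g) ⟨0, hr0⟩ * (Cp * ε)) = 1 := by
        rw [← hrel]; simp only [mul_assoc]
      exact eq_mul_inv_of_mul_eq (eq_inv_of_mul_eq_one_right h1)
    rw [hc0eq]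
    exact Subgroup.mul_mem _ (Subgroup.inv_mem _ (comm_prod_ite_mem _ _ haT hbT))
      (Subgroup.inv_mem _ (Subgroup.mul_mem _ (prod_map_finRange_ite_mem _ _ _ _ hcT) hεT))
  apply le_antisymm
  · rw [Subgroup.closure_le]
    rintro x (⟨i, hi, rfl | rfl⟩ | ⟨j, hj, rfl⟩ | rfl)
    · exact haT i hi
    · exact hbT i hi
    · by_cases hj0 : (j : ℕ) = 0
      · have : j = ⟨0, hr0⟩ := Fin.ext hj0
        rw [this]; exact hc0
      · exact hcT j ⟨by omega, hj⟩
    · exact hεT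
  · rw [Subgroup.closure_le]
    rintro _ ⟨y, hy, rfl⟩
    apply Subgroup.subset_closure
    rcases y with ⟨i, _ | _⟩ | j
    · exact Or.inl ⟨i, (hTl _).mp hy, Or.inl (ha i)⟩
    · exact Or.inl ⟨i, (hTl _).mp hy, Or.inr (hb i)⟩
    · have hj : (j : ℕ) + 1 ≤ s := (hTr _).mp hy
      by_cases hjs : (j : ℕ) + 1 = s
      · have : j = ⟨s - 1, by omega⟩ := Fin.ext (by simp only; omega)
        rw [this, hk (by omega)]
        exact Or.inr (Or.inr rfl)
      · rw [hc j hjs]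
        exact Or.inr (Or.inl ⟨Fin.succ j, by rw [Fin.val_succ]; omega, rfl⟩)

/-! ### The two cusps that are not members of the node-loop basis -/

include hε ha hb hc hk in
/-- **Nielsen move `c_{s+1} ↦ c_s` on the node-loop basis** (`1 ≤ s`, `s + 1 ≤ r'`: `C₀` carries the two
cusps `c_s`, `c_{s+1}`): `ε = c_s c_{s+1} (c_{s+2}⋯c_{r'}) ∏_{i<g₀}[a_i,b_i]` gives `c_s = u · c_{s+1}⁻¹`, `u` a
word in the other members; so a free basis agrees with `b'` off the slot `s` and carries `c_s` there.
[cite: LyndonSchupp2001, I.3 Prop 3.8] -/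
theorem exists_freeGroupBasis_nodeLoop_cusp (hs1 : 1 ≤ s) (hsr : s + 1 ≤ r') :
    ∃ b₄ : FreeGroupBasis ((Fin g × Bool) ⊕ Fin r') (PuncturedSurfaceGroup g (r' + 1)),
      b₄ (Sum.inr ⟨s, by omega⟩) = c ⟨s, by omega⟩ ∧
        ∀ j, j ≠ Sum.inr ⟨s, by omega⟩ → b₄ j = b' j := by
  classical
  set τ : (Fin g × Bool) ⊕ Fin r' := Sum.inr ⟨s, by omega⟩ with hτ
  have hsr' : s < r' + 1 := by omega
  have hsr'' : s + 1 < r' + 1 := by omega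
  have hτc : b' τ = c ⟨s + 1, hsr''⟩ := by
    rw [hτ, hc _ (by simp only; omega)]
    rfl
  -- `ε = c_s · (c_{s+1} · P₂) · A₀`
  set P₂ := ((List.finRange (r' + 1)).map fun j : Fin (r' + 1) =>
      if s + 1 + 1 ≤ (j : ℕ) then c (g := g) j else 1).prod with hP₂
  set A₀ := ((List.finRange g).map fun i : Fin g => if (i : ℕ) < g₀ then
      a (r := r' + 1) i * b i * (a i)⁻¹ * (b i)⁻¹ else 1).prod with hA₀
  have hε' : ε = c ⟨s, hsr'⟩ * (c ⟨s + 1, hsr''⟩ * P₂) * A₀ := by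
    rw [hε, prod_map_finRange_ite_le_peel (r' + 1) s hsr', prod_map_finRange_ite_le_peel (r' + 1) (s + 1)
      hsr'', mul_assoc]
  set u : PuncturedSurfaceGroup g (r' + 1) := ε * A₀⁻¹ * P₂⁻¹ with hu
  have hcs : c ⟨s, hsr'⟩ = u * (b' τ)⁻¹ := by
    rw [hτc, hu, hε']
    group
  -- `u` is a word in the members other than `τ`
  have hmem : ∀ x : (Fin g × Bool) ⊕ Fin r', x ≠ τ → b' x ∈ Subgroup.closure (b' '' {j | j ≠ τ}) :=
    fun x hx => Subgroup.subset_closure ⟨x, hx, rfl⟩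
  have haK : ∀ i, a (r := r' + 1) i ∈ Subgroup.closure (b' '' {j | j ≠ τ}) := fun i => by
    rw [← ha i]; exact hmem _ (by simp [hτ])
  have hbK : ∀ i, b (r := r' + 1) i ∈ Subgroup.closure (b' '' {j | j ≠ τ}) := fun i => by
    rw [← hb i]; exact hmem _ (by simp [hτ])
  have hεK : ε ∈ Subgroup.closure (b' '' {j | j ≠ τ}) := by
    rw [← hk (by omega)]
    refine hmem _ ?_
    simp only [hτ, Ne, Sum.inr.injEq, Fin.mk.injEq]
    omega
  have hcK : ∀ j : Fin (r' + 1), s + 1 + 1 ≤ (j : ℕ) →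
      c (g := g) j ∈ Subgroup.closure (b' '' {j | j ≠ τ}) :=
    fun j hj => nodeLoopBasis_cusp_mem_closure hc j (by omega) (by omega) fun k hk' => by
      simp only [Set.mem_setOf_eq, hτ, Ne, Sum.inr.injEq, Fin.ext_iff]; omega
  have huK : u ∈ Subgroup.closure (b' '' {j | j ≠ τ}) := by
    rw [hu]
    refine Subgroup.mul_mem _ (Subgroup.mul_mem _ hεK (Subgroup.inv_mem _ ?_))
      (Subgroup.inv_mem _ (prod_map_finRange_ite_mem _ _ _ _ hcK))
    exact comm_prod_ite_mem _ _ (fun i _ => haK i) (fun i _ => hbK i)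
  obtain ⟨b₄, hb₄τ, hb₄⟩ := exists_freeGroupBasis_update_mul_inv b' τ u huK
  exact ⟨b₄, by rw [hb₄τ, ← hcs], hb₄⟩

include hε ha hb hc hk in
/-- **Nielsen move `c_1 ↦ c_0` on the node-loop basis** (`2 ≤ s ≤ r'`: `C₁` carries the two cusps `c_0`,
`c_1`): the relation `(∏_{i≥g₀}[a_i,b_i]) c_0 c_1 (c_2⋯c_{s−1}) ε = 1` (`nodeLoop_rel`) gives
`c_0 = u · c_1⁻¹`, `u` a word in the other members; so a free basis agrees with `b'` off the slot `0` and
carries `c_0` there. [cite: LyndonSchupp2001, I.3 Prop 3.8] -/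
theorem exists_freeGroupBasis_nodeLoop_cusp_zero (hs2 : 2 ≤ s) (hsr : s ≤ r') :
    ∃ b₅ : FreeGroupBasis ((Fin g × Bool) ⊕ Fin r') (PuncturedSurfaceGroup g (r' + 1)),
      b₅ (Sum.inr ⟨0, by omega⟩) = c ⟨0, by omega⟩ ∧
        ∀ j, j ≠ Sum.inr ⟨0, by omega⟩ → b₅ j = b' j := by
  classical
  set κ : (Fin g × Bool) ⊕ Fin r' := Sum.inr ⟨0, by omega⟩ with hκ
  have hr0 : 0 < r' + 1 := Nat.succ_pos r'
  have hr1 : 1 < r' + 1 := by omega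
  have hκc : b' κ = c ⟨1, hr1⟩ := by
    rw [hκ, hc _ (by simp only; omega)]
    rfl
  -- `(∏_{i≥g₀}[a_i,b_i]) · (c_0 · (c_1 · Q₂)) · ε = 1`
  set Q₂ := ((List.finRange (r' + 1)).map fun j : Fin (r' + 1) =>
      if 2 ≤ (j : ℕ) ∧ (j : ℕ) < s then c (g := g) j else 1).prod with hQ₂
  set A₁ := ((List.finRange g).map fun i : Fin g => if g₀ ≤ (i : ℕ) then
      a (r := r' + 1) i * b i * (a i)⁻¹ * (b i)⁻¹ else 1).prod with hA₁
  have hrel : A₁ * (c ⟨0, hr0⟩ * (c ⟨1, hr1⟩ * Q₂)) * ε = 1 := by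
    have h := nodeLoop_rel (g := g) (r := r' + 1) g₀ s ε hε
    rwa [cusp_prod_lt_eq_c_zero_mul (g := g) s (by omega) hr0,
      cusp_prod_one_le_lt_eq_c_one_mul (g := g) s hs2 hr1] at h
  set u : PuncturedSurfaceGroup g (r' + 1) := A₁⁻¹ * ε⁻¹ * Q₂⁻¹ with hu
  have hc0 : c ⟨0, hr0⟩ = u * (b' κ)⁻¹ := by
    rw [hκc, hu]
    calc c (g := g) ⟨0, hr0⟩
        = A₁⁻¹ * (A₁ * (c ⟨0, hr0⟩ * (c ⟨1, hr1⟩ * Q₂)) * ε) * ε⁻¹ * Q₂⁻¹ * (c ⟨1, hr1⟩)⁻¹ := by group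
      _ = A₁⁻¹ * ε⁻¹ * Q₂⁻¹ * (c ⟨1, hr1⟩)⁻¹ := by rw [hrel]; group
  -- `u` is a word in the members other than `κ`
  have hmem : ∀ x : (Fin g × Bool) ⊕ Fin r', x ≠ κ → b' x ∈ Subgroup.closure (b' '' {j | j ≠ κ}) :=
    fun x hx => Subgroup.subset_closure ⟨x, hx, rfl⟩
  have haK : ∀ i, a (r := r' + 1) i ∈ Subgroup.closure (b' '' {j | j ≠ κ}) := fun i => by
    rw [← ha i]; exact hmem _ (by simp [hκ])
  have hbK : ∀ i, b (r := r' + 1) i ∈ Subgroup.closure (b' '' {j | j ≠ κ}) := fun i => by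
    rw [← hb i]; exact hmem _ (by simp [hκ])
  have hεK : ε ∈ Subgroup.closure (b' '' {j | j ≠ κ}) := by
    rw [← hk (by omega)]
    refine hmem _ ?_
    simp only [hκ, Ne, Sum.inr.injEq, Fin.mk.injEq]
    omega
  have hcK : ∀ j : Fin (r' + 1), 2 ≤ (j : ℕ) ∧ (j : ℕ) < s →
      c (g := g) j ∈ Subgroup.closure (b' '' {j | j ≠ κ}) :=
    fun j hj => nodeLoopBasis_cusp_mem_closure hc j (by omega) (by omega) fun k hk' => by
      simp only [Set.mem_setOf_eq, hκ, Ne, Sum.inr.injEq, Fin.ext_iff]; omega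
  have huK : u ∈ Subgroup.closure (b' '' {j | j ≠ κ}) := by
    rw [hu]
    refine Subgroup.mul_mem _ (Subgroup.mul_mem _ (Subgroup.inv_mem _ ?_) (Subgroup.inv_mem _ hεK))
      (Subgroup.inv_mem _ (prod_map_finRange_ite_mem _ _ _ _ hcK))
    exact comm_prod_ite_mem _ _ (fun i _ => haK i) (fun i _ => hbK i)
  obtain ⟨b₅, hb₅κ, hb₅⟩ := exists_freeGroupBasis_update_mul_inv b' κ u huK
  exact ⟨b₅, by rw [hb₅κ, ← hc0], hb₅⟩

end NodeLoopBasis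

end PuncturedSurfaceGroup

end Literature.GroupTheory.CombinatorialGroupTheory
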